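import Literature.Analysis.PDE.EvansKrylovJets
import Literature.Analysis.PDE.EvansKrylovOscillation
import Literature.Analysis.PDE.EvansKrylovOscillationAux
import Literature.Analysis.PDE.OscillationIteration
import Literature.Analysis.PDE.MotzkinWasow
import Literature.Analysis.Calculus.MultilinearComponentBounds
import Literature.Analysis.FunctionSpaces.HolderOnSetToolkit
import HarnessLib

/-!
# Evans–Krylov: Hölder continuity from the oscillation decay

The last step of the proof of Gilbarg–Trudinger's Theorem 17.14 (the interior `C^{2,α}` estimate
for concave fully nonlinear equations), p. 461 of the 2001 printing: "The desired Hölder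
estimates (17.41), (17.52) now follow immediately from Lemma 8.23", together with the
polarisation remark of §17.4 ("by using the last assertion of Lemma 17.13, we obtain a Hölder
estimate for `D²u`").

* `oscSum_nonneg`, `oscSum_le_card`, `oscSum_monotoneOn`, `abs_sub_le_oscSum` — bookkeeping for
  the oscillation sum `ω_{y₁}(r) = Σ_k osc_{B(y₁,r)} h_k` (`oscSum`) of finitely many
  `[0,1]`-valued functions `h_k`;
* `oscSum_le_of_decay` — Lemma 8.23 (`GilbargTrudinger.oscillation_lemma` with `μ = ½`) applied
  to the decay `ω(τR) ≤ γ₀ ω(R) + c₁R`, `0 < R ≤ R₁`: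
  `ω(R) ≤ (N/γ₀ + c₁R₁/(1 − γ₀)) (R/R₁)^α` for every `α ≤ min(½, ½ log γ₀ / log τ)`;
* `holderOnWith_of_oscSum_decay` — the Hölder estimate (17.41)/(17.52) for each `h_k` on the half
  ball `B(y₀,R₀/2)`, from the decay at every centre of the half ball: for `|x − y| ≤ R₁/2` one
  has `|h_k(x) − h_k(y)| ≤ ω_x(2|x − y|)`, and `|h_k(x) − h_k(y)| ≤ 1 ≤ (2|x − y|/R₁)^α`
  otherwise;
* `holderOnWith_iteratedFDeriv_two_of_quadHess` — Hölder continuity of `D²u = iteratedFDeriv ℝ 2 u`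
  from that of the pure second derivatives `quadHess u γ_k` along the Evans–Krylov directions
  `e_i`, `(e_i ± e_j)/√2` (polarisation `entry_eq_half_diag_sub`, `diag_entry_eq`, and
  `holderOnWith_multilinear_of_components`).

Everything here is proved; there are no definitions and no named facts.

## References

* D. Gilbarg, N. S. Trudinger, *Elliptic Partial Differential Equations of Second Order*,
  Classics in Mathematics, Springer (2001), Lemma 8.23 (pp. 201–202), §17.4, (17.41), (17.52),
  and the end of the proof of Theorem 17.14, p. 461. [GilbargTrudinger2001]
-/

noncomputable section

open Matrix Finset Metric Set NNReal
open scoped Topology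

namespace Literature.Analysis.PDE.EvansKrylov

open Literature.Analysis.Calculus Literature.Analysis.PDE.ABP

/-! ### Bookkeeping for the oscillation sum -/

section OscSum

variable {ι : Type*} [Fintype ι] {Kt : Type*} [Fintype Kt]

/-- A closed ball of radius `R₁ ≤ R₀/2` about a point of the half ball `B(y₀,R₀/2)` lies in the
ball `B(y₀,R₀)`. [folklore] -/
theorem closedBall_subset_ball_of_mem_half {E : Type*} [PseudoMetricSpace E] {y₀ y₁ : E}
    {R₀ R₁ : ℝ} (hy₁ : y₁ ∈ ball y₀ (R₀ / 2)) (hR₁ : R₁ ≤ R₀ / 2) :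
    closedBall y₁ R₁ ⊆ ball y₀ R₀ := fun y hy ↦ by
  rw [mem_ball] at hy₁ ⊢
  rw [mem_closedBall] at hy
  calc dist y y₀ ≤ dist y y₁ + dist y₁ y₀ := dist_triangle _ _ _
    _ < R₁ + R₀ / 2 := add_lt_add_of_le_of_lt hy hy₁
    _ ≤ R₀ := by linarith

/-- `0 ≤ ω(r)` for `0 < r ≤ R` when the `h_k` take values in `[0,1]` on `B̄(y₁,R)`.
[folklore] -/
theorem oscSum_nonneg {h : Kt → EuclideanSpace ℝ ι → ℝ} {y₁ : EuclideanSpace ℝ ι} {r R : ℝ}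
    (hr0 : 0 < r) (hr : r ≤ R) (h01 : ∀ k, ∀ y ∈ closedBall y₁ R, 0 ≤ h k y ∧ h k y ≤ 1) :
    0 ≤ oscSum h y₁ r :=
  Finset.sum_nonneg fun k _ ↦ by
    obtain ⟨-, h2, -⟩ := csInf_csSup_image_ball_mem hr0 hr (h01 k)
    linarith

/-- `ω(r) ≤ N = card Kt` for `0 < r ≤ R` when the `h_k` take values in `[0,1]` on `B̄(y₁,R)`
(each oscillation is at most `1`). [folklore] -/
theorem oscSum_le_card {h : Kt → EuclideanSpace ℝ ι → ℝ} {y₁ : EuclideanSpace ℝ ι} {r R : ℝ}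
    (hr0 : 0 < r) (hr : r ≤ R) (h01 : ∀ k, ∀ y ∈ closedBall y₁ R, 0 ≤ h k y ∧ h k y ≤ 1) :
    oscSum h y₁ r ≤ Fintype.card Kt := by
  calc oscSum h y₁ r ≤ ∑ _k : Kt, (1 : ℝ) := Finset.sum_le_sum fun k _ ↦ by
        obtain ⟨h1, -, h3⟩ := csInf_csSup_image_ball_mem hr0 hr (h01 k)
        linarith
    _ = Fintype.card Kt := by rw [Finset.sum_const, Finset.card_univ, nsmul_eq_mul, mul_one]

/-- The oscillation sum is non-decreasing in the radius on `(0, R]` when the `h_k` take values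
in `[0,1]` on `B̄(y₁,R)`. [folklore] -/
theorem oscSum_monotoneOn {h : Kt → EuclideanSpace ℝ ι → ℝ} {y₁ : EuclideanSpace ℝ ι} {R : ℝ}
    (h01 : ∀ k, ∀ y ∈ closedBall y₁ R, 0 ≤ h k y ∧ h k y ≤ 1) :
    MonotoneOn (oscSum h y₁) (Ioc 0 R) := by
  intro r hr r' hr' hrr'
  refine Finset.sum_le_sum fun k _ ↦ ?_
  have h01' : ∀ y ∈ closedBall y₁ r', 0 ≤ h k y ∧ h k y ≤ 1 := fun y hy ↦
    h01 k y (closedBall_subset_closedBall hr'.2 hy)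
  obtain ⟨hs, hi⟩ := csSup_image_ball_mono hr.1 hrr' h01'
  linarith

/-- `|h_k(x) − h_k(y)| ≤ osc_{B(y₁,r)} h_k ≤ ω(r)` for `x, y ∈ B(y₁,r)`, `r ≤ R`, when the `h_k`
take values in `[0,1]` on `B̄(y₁,R)`. [folklore] -/
theorem abs_sub_le_oscSum {h : Kt → EuclideanSpace ℝ ι → ℝ} {y₁ : EuclideanSpace ℝ ι} {r R : ℝ}
    (hr : r ≤ R) (h01 : ∀ k, ∀ y ∈ closedBall y₁ R, 0 ≤ h k y ∧ h k y ≤ 1) (k : Kt)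
    {x y : EuclideanSpace ℝ ι} (hx : x ∈ ball y₁ r) (hy : y ∈ ball y₁ r) :
    |h k x - h k y| ≤ oscSum h y₁ r := by
  have hr0 : 0 < r := lt_of_le_of_lt dist_nonneg (mem_ball.1 hx)
  obtain ⟨hxi, hxs⟩ := csInf_le_le_csSup_image_ball hr (h01 k) hx
  obtain ⟨hyi, hys⟩ := csInf_le_le_csSup_image_ball hr (h01 k) hy
  have hk : |h k x - h k y| ≤ sSup (h k '' ball y₁ r) - sInf (h k '' ball y₁ r) := by
    rw [abs_sub_le_iff]
    constructor <;> linarith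
  refine hk.trans ?_
  exact Finset.single_le_sum (f := fun l ↦ sSup (h l '' ball y₁ r) - sInf (h l '' ball y₁ r))
    (fun l _ ↦ by
      obtain ⟨-, h2, -⟩ := csInf_csSup_image_ball_mem hr0 hr (h01 l)
      linarith) (Finset.mem_univ k)

/-- **Lemma 8.23 applied to the oscillation sum** (`μ = ½`): if the `h_k` take values in `[0,1]`
on `B̄(y₁,R₁)` and `ω(τR) ≤ γ₀ ω(R) + c₁R` for `0 < R ≤ R₁` (`0 < τ, γ₀ < 1`, `c₁ ≥ 0`), then
for every exponent `α ≤ min(½, ½ log γ₀ / log τ)` and every `0 < R ≤ R₁`,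
`ω(R) ≤ (N/γ₀ + c₁R₁/(1 − γ₀)) (R/R₁)^α`, `N = card Kt`.
[cite: GilbargTrudinger2001, Lemma 8.23 and §17.4, p. 461] -/
theorem oscSum_le_of_decay {τ γ₀ : ℝ} (hτ0 : 0 < τ) (hτ1 : τ < 1) (hγ0 : 0 < γ₀) (hγ1 : γ₀ < 1)
    {α : ℝ} (hα2 : α ≤ 1 / 2) (hα' : α ≤ (1 - 1 / 2) * (Real.log γ₀ / Real.log τ))
    {c₁ R₁ : ℝ} (hc₁ : 0 ≤ c₁) (hR₁ : 0 < R₁)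
    {h : Kt → EuclideanSpace ℝ ι → ℝ} {y₁ : EuclideanSpace ℝ ι}
    (h01 : ∀ k, ∀ y ∈ closedBall y₁ R₁, 0 ≤ h k y ∧ h k y ≤ 1)
    (hdec : ∀ R ∈ Ioc 0 R₁, oscSum h y₁ (τ * R) ≤ γ₀ * oscSum h y₁ R + c₁ * R)
    {R : ℝ} (hR : R ∈ Ioc 0 R₁) :
    oscSum h y₁ R ≤ (Fintype.card Kt / γ₀ + c₁ * R₁ / (1 - γ₀)) * (R / R₁) ^ α := by
  obtain ⟨hR0, hRR₁⟩ := hR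
  have hσ : MonotoneOn (fun r : ℝ ↦ c₁ * r) (Ioc 0 R₁) := fun r _ r' _ hrr' ↦
    mul_le_mul_of_nonneg_left hrr' hc₁
  have hσ0 : ∀ r ∈ Ioc 0 R₁, 0 ≤ c₁ * r := fun r hr ↦ mul_nonneg hc₁ hr.1.le
  have hω0 : 0 ≤ oscSum h y₁ R₁ := oscSum_nonneg hR₁ le_rfl h01
  have hωN : oscSum h y₁ R₁ ≤ Fintype.card Kt := oscSum_le_card hR₁ le_rfl h01
  have hmain := GilbargTrudinger.oscillation_lemma (ω := oscSum h y₁) (σ := fun r ↦ c₁ * r)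
    (μ := 1 / 2) hR₁ hγ0 hγ1 hτ0 hτ1 (by norm_num) (by norm_num) (oscSum_monotoneOn h01) hσ
    hσ0 hω0 hdec ⟨hR0, hRR₁⟩
  have hq0 : 0 < R / R₁ := div_pos hR0 hR₁
  have hq1 : R / R₁ ≤ 1 := (div_le_one hR₁).2 hRR₁
  have hqα : 0 ≤ (R / R₁) ^ α := Real.rpow_nonneg hq0.le _
  have h1 : (R / R₁) ^ ((1 - 1 / 2) * (Real.log γ₀ / Real.log τ)) ≤ (R / R₁) ^ α :=
    Real.rpow_le_rpow_of_exponent_ge hq0 hq1 hα'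
  have h2 : R ^ (1 / 2 : ℝ) * R₁ ^ (1 - 1 / 2 : ℝ) ≤ R₁ * (R / R₁) ^ α := by
    have h3 : (R / R₁) ^ (1 / 2 : ℝ) ≤ (R / R₁) ^ α :=
      Real.rpow_le_rpow_of_exponent_ge hq0 hq1 hα2
    have h4 : R ^ (1 / 2 : ℝ) = (R / R₁) ^ (1 / 2 : ℝ) * R₁ ^ (1 / 2 : ℝ) := by
      rw [← Real.mul_rpow hq0.le hR₁.le, div_mul_cancel₀ R hR₁.ne']
    have h5 : R₁ ^ (1 / 2 : ℝ) * R₁ ^ (1 - 1 / 2 : ℝ) = R₁ := by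
      rw [← Real.rpow_add hR₁]
      norm_num
    calc R ^ (1 / 2 : ℝ) * R₁ ^ (1 - 1 / 2 : ℝ)
        = (R / R₁) ^ (1 / 2 : ℝ) * (R₁ ^ (1 / 2 : ℝ) * R₁ ^ (1 - 1 / 2 : ℝ)) := by
          rw [h4, mul_assoc]
      _ = (R / R₁) ^ (1 / 2 : ℝ) * R₁ := by rw [h5]
      _ ≤ (R / R₁) ^ α * R₁ := mul_le_mul_of_nonneg_right h3 hR₁.le
      _ = R₁ * (R / R₁) ^ α := mul_comm _ _
  have hA : 1 / γ₀ * (R / R₁) ^ ((1 - 1 / 2) * (Real.log γ₀ / Real.log τ)) * oscSum h y₁ R₁ ≤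
      1 / γ₀ * (R / R₁) ^ α * Fintype.card Kt := by
    have hγ' : 0 ≤ 1 / γ₀ := by positivity
    calc 1 / γ₀ * (R / R₁) ^ ((1 - 1 / 2) * (Real.log γ₀ / Real.log τ)) * oscSum h y₁ R₁
        ≤ 1 / γ₀ * (R / R₁) ^ α * oscSum h y₁ R₁ :=
          mul_le_mul_of_nonneg_right (mul_le_mul_of_nonneg_left h1 hγ') hω0
      _ ≤ 1 / γ₀ * (R / R₁) ^ α * Fintype.card Kt :=
          mul_le_mul_of_nonneg_left hωN (mul_nonneg hγ' hqα)
  have hB : 1 / (1 - γ₀) * (c₁ * (R ^ (1 / 2 : ℝ) * R₁ ^ (1 - 1 / 2 : ℝ))) ≤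
      1 / (1 - γ₀) * (c₁ * (R₁ * (R / R₁) ^ α)) := by
    have : 0 ≤ 1 / (1 - γ₀) := by
      have := sub_pos.2 hγ1
      positivity
    exact mul_le_mul_of_nonneg_left (mul_le_mul_of_nonneg_left h2 hc₁) this
  calc oscSum h y₁ R ≤ _ := hmain
    _ ≤ 1 / γ₀ * (R / R₁) ^ α * Fintype.card Kt + 1 / (1 - γ₀) * (c₁ * (R₁ * (R / R₁) ^ α)) :=
        add_le_add hA hB
    _ = (Fintype.card Kt / γ₀ + c₁ * R₁ / (1 - γ₀)) * (R / R₁) ^ α := by ring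

end OscSum

/-! ### The Hölder estimates -/

/-- **Hölder continuity from the oscillation decay** (Gilbarg–Trudinger, end of the proof of
Thm. 17.14: "The desired Hölder estimates now follow immediately from Lemma 8.23"). An exponent
`α ∈ (0,1)` depending only on `τ, γ₀`, and then a constant `B` depending only on
`τ, γ₀, card Kt, c₁, R₁`, such that: if finitely many functions `h_k` take values in `[0,1]` on
`B(y₀,R₀)` and their oscillation sum decays, `ω_{y₁}(τR) ≤ γ₀ ω_{y₁}(R) + c₁R` for every centre
`y₁ ∈ B(y₀,R₀/2)` and radius `R ≤ R₁` (`R₁ ≤ R₀/2`), then each `h_k` is `(B, α)`-Hölder on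
`B(y₀,R₀/2)` (Lemma 8.23 `GilbargTrudinger.oscillation_lemma` with `μ = ½` at every centre, and
`|h(x) − h(y)| ≤ osc_{B(x,2|x−y|)} h` for `|x − y| ≤ R₁/2`, `≤ 1 ≤ (2|x−y|/R₁)^α` otherwise).
[cite: GilbargTrudinger2001, Lemma 8.23 and §17.4, (17.41)] -/
theorem holderOnWith_of_oscSum_decay (ι : Type*) [Fintype ι] (Kt : Type*) [Fintype Kt]
    {τ γ₀ : ℝ} (hτ0 : 0 < τ) (hτ1 : τ < 1) (hγ0 : 0 < γ₀) (hγ1 : γ₀ < 1) :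
    ∃ α : ℝ≥0, 0 < α ∧ α < 1 ∧ ∀ {c₁ R₁ : ℝ}, 0 ≤ c₁ → 0 < R₁ → ∃ B : ℝ≥0,
      ∀ {h : Kt → EuclideanSpace ℝ ι → ℝ} {y₀ : EuclideanSpace ℝ ι} {R₀ : ℝ}, R₁ ≤ R₀ / 2 →
        (∀ k, ∀ y ∈ ball y₀ R₀, 0 ≤ h k y ∧ h k y ≤ 1) →
        (∀ y₁ ∈ ball y₀ (R₀ / 2), ∀ R ∈ Ioc 0 R₁,
          oscSum h y₁ (τ * R) ≤ γ₀ * oscSum h y₁ R + c₁ * R) →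
        ∀ k, HolderOnWith B α (h k) (ball y₀ (R₀ / 2)) := by
  -- the exponent `a = min (1/2, (1/2) log γ₀ / log τ)`
  have hα'0 : 0 < (1 - 1 / 2) * (Real.log γ₀ / Real.log τ) :=
    mul_pos (by norm_num) (div_pos_of_neg_of_neg (Real.log_neg hγ0 hγ1) (Real.log_neg hτ0 hτ1))
  set a : ℝ := min (1 / 2) ((1 - 1 / 2) * (Real.log γ₀ / Real.log τ)) with ha
  have ha0 : 0 < a := lt_min (by norm_num) hα'0
  have ha2 : a ≤ 1 / 2 := min_le_left _ _
  have haα' : a ≤ (1 - 1 / 2) * (Real.log γ₀ / Real.log τ) := min_le_right _ _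
  have ha1 : a < 1 := by linarith
  refine ⟨a.toNNReal, Real.toNNReal_pos.2 ha0, Real.toNNReal_lt_one.2 ha1, ?_⟩
  intro c₁ R₁ hc₁ hR₁
  -- the constant `B = (C₀ + 1) (2/R₁)^a`, `C₀ = N/γ₀ + c₁R₁/(1 − γ₀)`
  set C₀ : ℝ := Fintype.card Kt / γ₀ + c₁ * R₁ / (1 - γ₀) with hC₀
  have hC₀0 : 0 ≤ C₀ :=
    add_nonneg (div_nonneg (Nat.cast_nonneg _) hγ0.le)
      (div_nonneg (mul_nonneg hc₁ hR₁.le) (sub_pos.2 hγ1).le)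
  have hB0 : 0 ≤ (C₀ + 1) * (2 / R₁) ^ a :=
    mul_nonneg (by linarith) (Real.rpow_nonneg (by positivity) _)
  refine ⟨((C₀ + 1) * (2 / R₁) ^ a).toNNReal, ?_⟩
  intro h y₀ R₀ hR₁R₀ h01 hdec k
  refine holderOnWith_of_dist_le_rpow fun x hx y hy ↦ ?_
  rw [Real.coe_toNNReal _ ha0.le, Real.coe_toNNReal _ hB0]
  -- preliminaries: the two points, and the ball `B̄(x,R₁) ⊆ B(y₀,R₀)`
  have hR₀ : 0 < R₀ := by linarith [mem_ball.1 hx, dist_nonneg (x := x) (y := y₀)]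
  have hhalf : ball y₀ (R₀ / 2) ⊆ ball y₀ R₀ := ball_subset_ball (by linarith)
  obtain ⟨hx0, hx1⟩ := h01 k x (hhalf hx)
  obtain ⟨hy0, hy1⟩ := h01 k y (hhalf hy)
  have h01x : ∀ l, ∀ z ∈ closedBall x R₁, 0 ≤ h l z ∧ h l z ≤ 1 := fun l z hz ↦
    h01 l z (closedBall_subset_ball_of_mem_half hx hR₁R₀ hz)
  have hd0 : 0 ≤ dist x y := dist_nonneg
  have hident : (C₀ + 1) * (2 * dist x y / R₁) ^ a = (C₀ + 1) * (2 / R₁) ^ a * dist x y ^ a := by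
    rw [mul_div_right_comm, Real.mul_rpow (by positivity) hd0, ← mul_assoc]
  have hle1 : |h k x - h k y| ≤ 1 := by
    rw [abs_sub_le_iff]
    constructor <;> linarith
  rw [← hident, Real.dist_eq]
  by_cases hdR : R₁ < 2 * dist x y
  · -- far apart: `|h x − h y| ≤ 1 ≤ (2d/R₁)^a`
    have h1 : 1 ≤ (2 * dist x y / R₁) ^ a :=
      Real.one_le_rpow ((one_le_div hR₁).2 hdR.le) ha0.le
    exact hle1.trans (one_le_mul_of_one_le_of_one_le (by linarith) h1)
  · have hdR : 2 * dist x y ≤ R₁ := not_lt.1 hdR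
    rcases hd0.eq_or_lt with hd00 | hdpos
    · -- `x = y`
      have hxy : x = y := dist_eq_zero.1 hd00.symm
      rw [hxy, sub_self, abs_zero]
      exact mul_nonneg (by linarith) (Real.rpow_nonneg (by positivity) _)
    · -- `0 < d ≤ R₁/2`: `|h x − h y| ≤ ω_x(2d) ≤ C₀ (2d/R₁)^a`
      have hmem : 2 * dist x y ∈ Ioc 0 R₁ := ⟨by linarith, hdR⟩
      have hxb : x ∈ ball x (2 * dist x y) := mem_ball_self (by linarith)
      have hyb : y ∈ ball x (2 * dist x y) := by
        rw [mem_ball, dist_comm]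
        linarith
      calc |h k x - h k y| ≤ oscSum h x (2 * dist x y) := abs_sub_le_oscSum hdR h01x k hxb hyb
        _ ≤ C₀ * (2 * dist x y / R₁) ^ a :=
          oscSum_le_of_decay hτ0 hτ1 hγ0 hγ1 ha2 haα' hc₁ hR₁ h01x (hdec x hx) hmem
        _ ≤ (C₀ + 1) * (2 * dist x y / R₁) ^ a := by
          gcongr
          linarith

/-- **Hölder continuity of the Hessian from that of the pure second derivatives along the
Evans–Krylov directions** ("by using the last assertion of Lemma 17.13, we obtain a Hölder
estimate for `D²u`"): if the family `γ_k` contains `e_i` and `(e_i ± e_j)/√2` and every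
`D_{γ_kγ_k}u = quadHess u γ_k` is `(B, α)`-Hölder on a set on which the Hessian matrices of `u`
are symmetric, then `D²u = iteratedFDeriv ℝ 2 u` is `((card ι)²·B, α)`-Hölder there
(polarisation `entry_eq_half_diag_sub`, `diag_entry_eq`, and
`holderOnWith_multilinear_of_components`). [cite: GilbargTrudinger2001, §17.4, (17.41)] -/
theorem holderOnWith_iteratedFDeriv_two_of_quadHess {ι : Type*} [Fintype ι] [DecidableEq ι]
    {u : EuclideanSpace ℝ ι → ℝ} {s : Set (EuclideanSpace ℝ ι)}
    (hsymm : ∀ y ∈ s, (hessianMatrix u (EuclideanSpace.basisFun ι ℝ) y).IsSymm)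
    {Kt : Type*} [Fintype Kt] {γ : Kt → ι → ℝ}
    (hdiag : ∀ i, ∃ k, γ k = Pi.single i 1)
    (hoff : ∀ i j, i ≠ j →
      (∃ k, γ k = (Real.sqrt 2)⁻¹ • (Pi.single i 1 + Pi.single j 1)) ∧
      (∃ k, γ k = (Real.sqrt 2)⁻¹ • (Pi.single i 1 - Pi.single j 1)))
    {B α : ℝ≥0} (hB : ∀ k, HolderOnWith B α (quadHess u (γ k)) s) :
    HolderOnWith ((Fintype.card ι) ^ 2 * B) α (iteratedFDeriv ℝ 2 u) s := by
  refine holderOnWith_multilinear_of_components (EuclideanSpace.basisFun ι ℝ) (n := 2)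
    fun I ↦ ?_
  -- the component `x ↦ D²u(x)(e_{I 0}, e_{I 1})` is the Hessian entry `H(x)_{I 0, I 1}`
  have hcomp : ∀ x, iteratedFDeriv ℝ 2 u x (fun k ↦ EuclideanSpace.basisFun ι ℝ (I k)) =
      hessianMatrix u (EuclideanSpace.basisFun ι ℝ) x (I 0) (I 1) := fun x ↦ by
    rw [iteratedFDeriv_two_apply, hessianMatrix_apply]
  refine holderOnWith_of_dist_le_rpow fun x hx y hy ↦ ?_
  simp only [hcomp]
  by_cases hij : I 0 = I 1
  · -- a diagonal entry: `H_{ii} = quadHess u e_i`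
    obtain ⟨k, hk⟩ := hdiag (I 1)
    have hq : ∀ z, hessianMatrix u (EuclideanSpace.basisFun ι ℝ) z (I 0) (I 1) =
        quadHess u (γ k) z := fun z ↦ by
      rw [hij, diag_entry_eq ι (hessianMatrix u (EuclideanSpace.basisFun ι ℝ) z) (I 1),
        quadHess_eq, hk]
    rw [hq, hq]
    exact (hB k).dist_le hx hy
  · -- an off-diagonal entry: `H_{ij} = (quadHess u γ⁺ − quadHess u γ⁻)/2` (polarisation)
    obtain ⟨⟨k₁, hk₁⟩, ⟨k₂, hk₂⟩⟩ := hoff (I 0) (I 1) hij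
    have hq : ∀ z ∈ s, hessianMatrix u (EuclideanSpace.basisFun ι ℝ) z (I 0) (I 1) =
        (quadHess u (γ k₁) z - quadHess u (γ k₂) z) / 2 := fun z hz ↦ by
      rw [entry_eq_half_diag_sub ι _ (hsymm z hz) hij, quadHess_eq, quadHess_eq, hk₁, hk₂]
    rw [hq x hx, hq y hy, Real.dist_eq]
    have h1 := (hB k₁).dist_le hx hy
    have h2 := (hB k₂).dist_le hx hy
    rw [Real.dist_eq] at h1 h2
    have hre : (quadHess u (γ k₁) x - quadHess u (γ k₂) x) / 2 -
        (quadHess u (γ k₁) y - quadHess u (γ k₂) y) / 2 =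
        ((quadHess u (γ k₁) x - quadHess u (γ k₁) y) -
          (quadHess u (γ k₂) x - quadHess u (γ k₂) y)) / 2 := by ring
    rw [hre, abs_div, abs_two]
    calc |(quadHess u (γ k₁) x - quadHess u (γ k₁) y) -
          (quadHess u (γ k₂) x - quadHess u (γ k₂) y)| / 2
        ≤ (|quadHess u (γ k₁) x - quadHess u (γ k₁) y| +
            |quadHess u (γ k₂) x - quadHess u (γ k₂) y|) / 2 := by
          gcongr
          exact abs_sub _ _
      _ ≤ (B * dist x y ^ (α : ℝ) + B * dist x y ^ (α : ℝ)) / 2 := by gcongr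
      _ = B * dist x y ^ (α : ℝ) := by ring

end Literature.Analysis.PDE.EvansKrylov

end
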